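import Summits.HodgeConjecture.HodgeConjecture.Theorems.HeckePrymWeilDeligneWeilFamilyIff
import Summits.HodgeConjecture.HodgeConjecture.Theorems.HeckePrymWeilWeilTwelvefoldsSqrtMinus7OfWeilTransport
import HarnessLib

/-!
# `WeilVariationalHodge` (stmt-HodgeConjecture-14497): the Weil-transport restatement, certified against the ROUTE DECLS

Route `HeckePrymWeil` (sub-problem `HodgeConjecture`); lead c2 of crux `WeilVariationalHodge`, line `Sketch`.

Three leads (c0, c1, c2) found the crux AS TYPED — Grothendieck's variational Hodge statement for ALL
fibrewise-rational `(M,M)` global classes along smooth proper families of `√-p`-abelian `2M`-folds — to be the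
crux itself in every typing (HC-sandwiched; informally as hard as the Hodge conjecture for abelian varieties),
and recommended RESTATING it as the **Weil transport** `WT(p, M)`: the same transport statement for global
classes that lie, at every fibre and through a chart `e' : A' ≅ 𝒳_s` of a `√-p`-abelian `2M`-fold, in the
strong Weil plane `weilClassesOf A' φ' M p`.  The sibling leads of stmt-1261 certified `WT` against the
LITERATURE facts (`hodgeWeil_iff_weilTransport_of_globalAction`, `hodgeWeilLadder_iff_weilTransport_of_levelStructure`).
This file certifies the restatement against the ROUTE'S OWN DECLS, which is what the planner's deciding theorem
composes — sorry-free, no new definition, no named-fact hypothesis: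

* `weilTransportAll_of_weilVariationalHodge` — the restatement is WEAKER than the crux as typed
  (`WeilVariationalHodge → ∀ p M, WT(p, M)`);
* `hodgeWeilSector_of_deligneWeilFamily_of_weilTransportAll` — it still closes the route's sector glue:
  `DeligneWeilFamily → (∀ p M, WT(p, M)) →` the whole `ℚ(√-p)` Hodge–Weil sector (the consequent of the
  route decl `FamilySectorGlue` verbatim, i.e. the antecedent of `SummitOffWeilSector`);
* `hodgeWeilLadder_of_deligneWeilFamily_of_weilTransportAll` — hence the route TARGET `HodgeWeilLadder`;
* `weilTransportAll_of_hodgeWeilLadder` — TIGHTNESS: the target alone gives back `∀ p M, WT(p, M)`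
  (ladder + the proved `WeilDescending` ⟹ every rung `HWA(p, M)`, `M ≥ 1` ⟹ `WT(p, M)` fibre by fibre);
* `hodgeWeilLadder_iff_weilTransportAll_of_deligneWeilFamily` — so, GIVEN the route item `DeligneWeilFamily`
  (stmt-HodgeConjecture-16866), the target is EQUIVALENT to the restated crux: with 14497 := `∀ p M, WT(p, M)`
  the route is exactly the bet "Deligne's family + Weil transport", nothing stronger.
-/

noncomputable section

-- every declaration of this problem lives in `Summit.HodgeConjecture.HodgeConjecture.…` (summit = sub-problem)
set_option linter.dupNamespace false

open CategoryTheory AlgebraicGeometry Limits MonoidalCategory CartesianMonoidalCategory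

namespace Summit.HodgeConjecture.HodgeConjecture.Theorems.HeckePrymWeilLine

open Literature.AlgebraicGeometry Literature.AlgebraicGeometry.Motives Literature.AlgebraicGeometry.HodgeTheory
open Summit.HodgeConjecture.HodgeConjecture.Theses.HeckePrymWeil

/-- **The Weil-transport restatement is weaker than the crux as typed**: `WeilVariationalHodge` (transport of
ALL fibrewise-rational `(M,M)` global classes) implies `WT(p, M)` for every `p`, `M` in range (the chart of the
Weil clause supplies the `Nonempty (A'.X ≅ 𝒳_s)` clause; `weilTransport_of_transport`).
[cite: Grothendieck1966, footnote 13] -/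
theorem weilTransportAll_of_weilVariationalHodge (hV : WeilVariationalHodge) :
    ∀ p : ℕ, p.Prime → p % 4 = 3 → 7 ≤ p → ∀ M : ℕ, 1 ≤ M →
      ∀ ⦃𝒳 S : SchemeOver ℂ⦄ (f : 𝒳 ⟶ S), IsSmoothProjectiveFamily f (2 * M) →
      IrreducibleSpace S.left → AlgebraicGeometry.Smooth S.hom →
      ∀ (W : complexBetti 𝒳 (2 * M)),
        (∀ s : ComplexPoints S, IsRationalClass (complexBetti.map (fiberι f s) (2 * M) W) ∧
          IsOfHodgeType (2 * M) (fiberOver f s) (2 * M) M M (complexBetti.map (fiberι f s) (2 * M) W)) →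
        (∀ s : ComplexPoints S, ∃ (A' : AbelianVariety ℂ) (φ' : A' ⟶ A') (e' : A'.X ≅ fiberOver f s),
          A'.dim = 2 * M ∧ φ' ≫ φ' = -((p : ℤ) • 𝟙 A') ∧
          complexBetti.map e'.hom (2 * M) (complexBetti.map (fiberι f s) (2 * M) W) ∈
            weilClassesOf A' φ' M p) →
        (∃ s₀ : ComplexPoints S,
          complexBetti.map (fiberι f s₀) (2 * M) W ∈ algebraicClasses (fiberOver f s₀) M) →
        ∀ s : ComplexPoints S,
          complexBetti.map (fiberι f s) (2 * M) W ∈ algebraicClasses (fiberOver f s) M :=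
  fun p hp hp4 hp7 M hM => weilTransport_of_transport (hV p hp hp4 hp7 M hM)

/-- **The restated crux still closes the route's sector glue** — `FamilySectorGlue` with the Weil transport in
place of `WeilVariationalHodge`: the route item `DeligneWeilFamily` gives Deligne's global-action package
(`globalAction_of_deligneWeilFamily`), and with it `WT(p, n)` gives the rung `HWA(p, n)` for every `n ≥ 1`
(`hodgeWeil_of_weilTransport_of_globalAction`: flat Weil section through the class, algebraic at the tensor-split
fibre, transported, read back through the chart).  The conclusion is the consequent of `FamilySectorGlue`
verbatim. [cite: Deligne1982HodgeCycles, proof of Thm. 4.8 (pp. 47–52) with Prop. 4.4, Lemma 4.5]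
[cite: Grothendieck1966, footnote 13] -/
theorem hodgeWeilSector_of_deligneWeilFamily_of_weilTransportAll (hF : DeligneWeilFamily)
    (hT : ∀ p : ℕ, p.Prime → p % 4 = 3 → 7 ≤ p → ∀ M : ℕ, 1 ≤ M →
      ∀ ⦃𝒳 S : SchemeOver ℂ⦄ (f : 𝒳 ⟶ S), IsSmoothProjectiveFamily f (2 * M) →
      IrreducibleSpace S.left → AlgebraicGeometry.Smooth S.hom →
      ∀ (W : complexBetti 𝒳 (2 * M)),
        (∀ s : ComplexPoints S, IsRationalClass (complexBetti.map (fiberι f s) (2 * M) W) ∧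
          IsOfHodgeType (2 * M) (fiberOver f s) (2 * M) M M (complexBetti.map (fiberι f s) (2 * M) W)) →
        (∀ s : ComplexPoints S, ∃ (A' : AbelianVariety ℂ) (φ' : A' ⟶ A') (e' : A'.X ≅ fiberOver f s),
          A'.dim = 2 * M ∧ φ' ≫ φ' = -((p : ℤ) • 𝟙 A') ∧
          complexBetti.map e'.hom (2 * M) (complexBetti.map (fiberι f s) (2 * M) W) ∈
            weilClassesOf A' φ' M p) →
        (∃ s₀ : ComplexPoints S,
          complexBetti.map (fiberι f s₀) (2 * M) W ∈ algebraicClasses (fiberOver f s₀) M) →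
        ∀ s : ComplexPoints S,
          complexBetti.map (fiberι f s) (2 * M) W ∈ algebraicClasses (fiberOver f s) M) :
    ∀ p : ℕ, p.Prime → p % 4 = 3 → 7 ≤ p → ∀ n : ℕ, 1 ≤ n →
      ∀ (A : AbelianVariety ℂ) (φ : A ⟶ A), A.dim = 2 * n → φ ≫ φ = -((p : ℤ) • 𝟙 A) →
        ∀ c : complexBetti A.X (2 * n), IsRationalClass c → IsOfHodgeType (2 * n) A.X (2 * n) n n c →
          c ∈ Module.End.eigenspace (complexBetti.map (𝟙 A + φ).hom.hom.hom (2 * n)).hom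
                ((1 + Complex.I * (Real.sqrt (p : ℝ) : ℂ)) ^ (2 * n)) ⊔
              Module.End.eigenspace (complexBetti.map (𝟙 A + φ).hom.hom.hom (2 * n)).hom
                ((1 - Complex.I * (Real.sqrt (p : ℝ) : ℂ)) ^ (2 * n)) →
          c ∈ algebraicClasses A.X n := by
  intro p hp hp4 hp7 n hn
  exact hodgeWeil_of_weilTransport_of_globalAction (globalAction_of_deligneWeilFamily hF) hp hp4 hp7 hn
    (hT p hp hp4 hp7 n hn)

/-- **The route TARGET from the route item `DeligneWeilFamily` and the restated crux**: `HodgeWeilLadder`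
(stmt-HodgeConjecture-1259) — rung `(p, g)` is `HWA(p, (p-1)/2·(g-1))` with `(p-1)/2·(g-1) ≥ 3 ≥ 1`
(`owf_three_le_k`). [cite: Deligne1982HodgeCycles, proof of Thm. 4.8] [cite: Grothendieck1966, footnote 13] -/
theorem hodgeWeilLadder_of_deligneWeilFamily_of_weilTransportAll (hF : DeligneWeilFamily)
    (hT : ∀ p : ℕ, p.Prime → p % 4 = 3 → 7 ≤ p → ∀ M : ℕ, 1 ≤ M →
      ∀ ⦃𝒳 S : SchemeOver ℂ⦄ (f : 𝒳 ⟶ S), IsSmoothProjectiveFamily f (2 * M) →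
      IrreducibleSpace S.left → AlgebraicGeometry.Smooth S.hom →
      ∀ (W : complexBetti 𝒳 (2 * M)),
        (∀ s : ComplexPoints S, IsRationalClass (complexBetti.map (fiberι f s) (2 * M) W) ∧
          IsOfHodgeType (2 * M) (fiberOver f s) (2 * M) M M (complexBetti.map (fiberι f s) (2 * M) W)) →
        (∀ s : ComplexPoints S, ∃ (A' : AbelianVariety ℂ) (φ' : A' ⟶ A') (e' : A'.X ≅ fiberOver f s),
          A'.dim = 2 * M ∧ φ' ≫ φ' = -((p : ℤ) • 𝟙 A') ∧
          complexBetti.map e'.hom (2 * M) (complexBetti.map (fiberι f s) (2 * M) W) ∈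
            weilClassesOf A' φ' M p) →
        (∃ s₀ : ComplexPoints S,
          complexBetti.map (fiberι f s₀) (2 * M) W ∈ algebraicClasses (fiberOver f s₀) M) →
        ∀ s : ComplexPoints S,
          complexBetti.map (fiberι f s) (2 * M) W ∈ algebraicClasses (fiberOver f s) M) :
    HodgeWeilLadder := by
  intro p hp hp4 hp7 g hg n hn A φ hA hφ c hrat hH hW
  have hn1 : 1 ≤ n := by have := owf_three_le_k hp7 hg hn; omega
  exact hodgeWeilSector_of_deligneWeilFamily_of_weilTransportAll hF hT p hp hp4 hp7 n hn1 A φ hA hφ c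
    hrat hH hW

/-- **TIGHTNESS: the target alone gives back the restated crux.**  `HodgeWeilLadder` and the PROVED support
`WeilDescending` (`Theorems.weilDescending_proof`) give `HWA(p, M)` for every `M ≥ 1` by descending from the
rungs `(p-1)/2·(g-1)` (`heckePrymWeil_ladder_descent`), and `HWA(p, M)` makes the conclusion of `WT(p, M)` hold at
every fibre outright (`weilTransport_of_hodgeWeil`: read `W|_{𝒳_s}` in the chart, apply `HWA`, return by
iso-invariance) — no family structure and no named fact is used. [cite: vanGeemen1994HodgeAV, 4.9]
[cite: Fulton1998, §19.1] -/
theorem weilTransportAll_of_hodgeWeilLadder (hL : HodgeWeilLadder) :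
    ∀ p : ℕ, p.Prime → p % 4 = 3 → 7 ≤ p → ∀ M : ℕ, 1 ≤ M →
      ∀ ⦃𝒳 S : SchemeOver ℂ⦄ (f : 𝒳 ⟶ S), IsSmoothProjectiveFamily f (2 * M) →
      IrreducibleSpace S.left → AlgebraicGeometry.Smooth S.hom →
      ∀ (W : complexBetti 𝒳 (2 * M)),
        (∀ s : ComplexPoints S, IsRationalClass (complexBetti.map (fiberι f s) (2 * M) W) ∧
          IsOfHodgeType (2 * M) (fiberOver f s) (2 * M) M M (complexBetti.map (fiberι f s) (2 * M) W)) →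
        (∀ s : ComplexPoints S, ∃ (A' : AbelianVariety ℂ) (φ' : A' ⟶ A') (e' : A'.X ≅ fiberOver f s),
          A'.dim = 2 * M ∧ φ' ≫ φ' = -((p : ℤ) • 𝟙 A') ∧
          complexBetti.map e'.hom (2 * M) (complexBetti.map (fiberι f s) (2 * M) W) ∈
            weilClassesOf A' φ' M p) →
        (∃ s₀ : ComplexPoints S,
          complexBetti.map (fiberι f s₀) (2 * M) W ∈ algebraicClasses (fiberOver f s₀) M) →
        ∀ s : ComplexPoints S,
          complexBetti.map (fiberι f s) (2 * M) W ∈ algebraicClasses (fiberOver f s) M := by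
  intro p hp hp4 hp7 M hM
  refine weilTransport_of_hodgeWeil (p := p) (k := M) ?_
  -- `HWA(p, M)` for every `M ≥ 1` from the ladder and the proved `WeilDescending`
  exact Theorems.heckePrymWeil_ladder_descent
    (fun n ↦ ∀ (A : AbelianVariety ℂ) (φ : A ⟶ A), A.dim = 2 * n → φ ≫ φ = -((p : ℤ) • 𝟙 A) →
      ∀ c : complexBetti A.X (2 * n), IsRationalClass c → IsOfHodgeType (2 * n) A.X (2 * n) n n c →
        c ∈ Module.End.eigenspace (complexBetti.map (𝟙 A + φ).hom.hom.hom (2 * n)).hom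
              ((1 + Complex.I * (Real.sqrt (p : ℝ) : ℂ)) ^ (2 * n)) ⊔
            Module.End.eigenspace (complexBetti.map (𝟙 A + φ).hom.hom.hom (2 * n)).hom
              ((1 - Complex.I * (Real.sqrt (p : ℝ) : ℂ)) ^ (2 * n)) →
        c ∈ algebraicClasses A.X n)
    ((p - 1) / 2) (by omega) (hL p hp hp4 hp7) (Theorems.weilDescending_proof p hp hp4 hp7) M hM

/-- **GIVEN the route item `DeligneWeilFamily`, the route target `HodgeWeilLadder` is EQUIVALENT to the
Weil-transport restatement of the crux** (`weilTransportAll_of_hodgeWeilLadder`,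
`hodgeWeilLadder_of_deligneWeilFamily_of_weilTransportAll`): restated as `∀ p M, WT(p, M)`, item
stmt-HodgeConjecture-14497 is exactly as strong as the route needs and no stronger.
[cite: Deligne1982HodgeCycles, proof of Thm. 4.8] [cite: Grothendieck1966, footnote 13] -/
theorem hodgeWeilLadder_iff_weilTransportAll_of_deligneWeilFamily (hF : DeligneWeilFamily) :
    HodgeWeilLadder ↔
    ∀ p : ℕ, p.Prime → p % 4 = 3 → 7 ≤ p → ∀ M : ℕ, 1 ≤ M →
      ∀ ⦃𝒳 S : SchemeOver ℂ⦄ (f : 𝒳 ⟶ S), IsSmoothProjectiveFamily f (2 * M) →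
      IrreducibleSpace S.left → AlgebraicGeometry.Smooth S.hom →
      ∀ (W : complexBetti 𝒳 (2 * M)),
        (∀ s : ComplexPoints S, IsRationalClass (complexBetti.map (fiberι f s) (2 * M) W) ∧
          IsOfHodgeType (2 * M) (fiberOver f s) (2 * M) M M (complexBetti.map (fiberι f s) (2 * M) W)) →
        (∀ s : ComplexPoints S, ∃ (A' : AbelianVariety ℂ) (φ' : A' ⟶ A') (e' : A'.X ≅ fiberOver f s),
          A'.dim = 2 * M ∧ φ' ≫ φ' = -((p : ℤ) • 𝟙 A') ∧
          complexBetti.map e'.hom (2 * M) (complexBetti.map (fiberι f s) (2 * M) W) ∈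
            weilClassesOf A' φ' M p) →
        (∃ s₀ : ComplexPoints S,
          complexBetti.map (fiberι f s₀) (2 * M) W ∈ algebraicClasses (fiberOver f s₀) M) →
        ∀ s : ComplexPoints S,
          complexBetti.map (fiberι f s) (2 * M) W ∈ algebraicClasses (fiberOver f s) M :=
  ⟨weilTransportAll_of_hodgeWeilLadder, hodgeWeilLadder_of_deligneWeilFamily_of_weilTransportAll hF⟩

end Summit.HodgeConjecture.HodgeConjecture.Theorems.HeckePrymWeilLine

end
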